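import Mathlib
import HarnessLib
import Summits.Langlands.Langlands.Theses.SkinnerWilesDefectOne
import Summits.Langlands.Langlands.Theorems.SkinnerWilesDefectOneReducibleOrdinaryProModularDefs
import Summits.Langlands.Langlands.Theorems.SkinnerWilesDefectOneProModularOfEisensteinSeedProModularPrimes
import Summits.Langlands.Langlands.Theorems.SkinnerWilesDefectOneProModularOfEisensteinSeedProModularPoints
import Summits.Langlands.Langlands.Theorems.SkinnerWilesDefectOneProModularOfEisensteinSeedHeckeGenerators
import Summits.Langlands.Langlands.Theorems.SkinnerWilesDefectOneProModularOfEisensteinSeedAdicCompact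
import Summits.Langlands.Langlands.Theorems.EisensteinProModularSeed.Negative.BorelAndEisenstein
import Literature.NumberTheory.GaloisRepresentations.NearlyOrdinaryDeformationRingProofs

/-!
# Pro-modular primes versus `p`-adically automorphic points: the entrance `r ⟹ ker φ_r`

Route `SkinnerWilesDefectOne`, support item stmt-Langlands-14718
(`ProModularOfEisensteinSeed : EisensteinProModularSeed → ReducibleOrdinaryProModular`).  This is where
the item's HYPOTHESIS enters Skinner–Wiles' propagation: the seed supplies ONE `p`-adically automorphic
point `r : Γ_F → GL₂(ℚ̄_p)` of the `R_𝒟`-type problem ([SW, §4.4, proof of Prop. 4.2]: "(P2) holds for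
some deformation datum `𝒟₀`", i.e. `R_{𝒟₀}` has a nice — in particular pro-modular — prime), and
steps (I)+(III) then work with the pro-modular PRIME `𝔭_r = ker φ_r` of `R_𝒟` ([SW, §4.1, p. 62]:
"a deformation … is a pro-modular deformation if the kernel of the corresponding map `R_𝒟 → A` is a
pro-modular prime").  We prove this entrance of the point/prime dictionary for the tree's objects:

* `apply_mem_range_of_isAssociated` — if the continuous eigensystem `x : 𝕋(𝒰) → ℚ̄_p` of `r` is
  realised through a continuous `φ : R_𝒟 → ℚ̄_p` (`φ ∘ ρ_𝒟 = P⁻¹ r P`) and the `q_v`, `v ∉ S`, are units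
  of `R_𝒟`, then `x` takes ALL its values in `φ(R_𝒟)`: on the generators `T_{v,0} = 1`,
  `T_{v,1} = tr`, `T_{v,i≥2} = q_v⁻¹ det`, `[U t_{v,2}⁻¹ U] = (q_v⁻¹ det)⁻¹` of Frobenius (the landed
  generator identities `…HeckeGenerators`), hence on the generated subring, hence — `φ(R_𝒟)` being
  compact (`…AdicCompact`) and so closed — on its closure `𝕋(𝒰)`;
* `isProModularPrimeAt_ker_of_isPadicallyAutomorphic` — **consequently `ker φ` is a pro-modular prime
  of `R_𝒟` at level `𝒰`**: the point factors as `𝕋(𝒰) → φ(R_𝒟) ≅ R_𝒟/ker φ`, continuously for the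
  `𝔪`-adic topology (a continuous bijection from the compact `R_𝒟/ker φ` onto the Hausdorff `φ(R_𝒟)` is
  a homeomorphism), and the association data descend along the injection `R_𝒟/ker φ ↪ ℚ̄_p`.

Hypotheses kept explicit and honest: `φ` continuous (true for the classifying map of an
`𝒪_E`-lattice), `k` finite (the route's `ModelData`), `q_v ∈ R_𝒟ˣ` for `v ∉ S` (automatic when the
residue characteristic is `p ∉ v`).

References: C. M. Skinner, A. J. Wiles, *Residually reducible representations and modular forms*,
Publ. Math. IHÉS 89 (1999), §4.1 (p. 62), §4.4. [SkinnerWiles1999]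
-/

set_option linter.dupNamespace false -- project-wide option (lakefile weak.linter.dupNamespace); `Summit.Langlands.Langlands` is the mandated namespace

namespace Summit.Langlands.Langlands.Cruxes.ReducibleOrdinaryProModular.SteinbergHyperplane

open scoped NumberField MatrixGroups
open IsDedekindDomain Field Polynomial Matrix IsLocalRing Filter Topology
open Literature.NumberTheory.Automorphic Literature.NumberTheory.Automorphic.BigHeckeGLn
open Literature.NumberTheory.GaloisRepresentations
open Summit.Langlands.Langlands.Theorems

noncomputable section

variable {F : Type} [Field F] [NumberField F] {p : ℕ} [Fact p.Prime]
variable {𝒪 : Type} [CommRing 𝒪] {k : Type} [Field k] [Algebra 𝒪 k] {𝒟 : NearlyOrdinaryDatum F p 𝒪 k}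
variable (𝓡 : NearlyOrdinaryDeformationRing.{0} 𝒟)

omit [Fact p.Prime] in
/-- The residue field of `R_𝒟` is `k` (the augmentation `π` is onto with kernel `𝔪`); in particular it
is finite when `k` is. [folklore] -/
theorem finite_residueField [Finite k] : Finite (ResidueField 𝓡.R) := by
  have e : 𝓡.R ⧸ RingHom.ker (𝓡.π : 𝓡.R →+* k) ≃+* k :=
    RingHom.quotientKerEquivOfSurjective 𝓡.π_surjective
  have e' : ResidueField 𝓡.R ≃+* 𝓡.R ⧸ RingHom.ker (𝓡.π : 𝓡.R →+* k) :=
    Ideal.quotEquivOfEq 𝓡.ker_π.symm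
  exact Finite.of_equiv k (e'.trans e).symm.toEquiv

/-- **The values of the eigensystem of `r` lie in `φ(R_𝒟)`** (see the module docstring).
[cite: SkinnerWiles1999, §4.1 p. 62] -/
theorem apply_mem_range_of_isAssociated [Finite k] (𝒰 : TameLevel 2 F p)
    (φ : 𝓡.R →+* PadicAlgCl p)
    (hφ : @Continuous 𝓡.R (PadicAlgCl p) (maximalIdeal 𝓡.R).adicTopology _ φ)
    (hq : ∀ v ∉ 𝒰.bad, IsUnit ((Ideal.absNorm v.asIdeal : ℕ) : 𝓡.R))
    (r : FramedGaloisRep F (PadicAlgCl p) 2) (P : GL (Fin 2) (PadicAlgCl p))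
    (hreal : ∀ g, Matrix.GeneralLinearGroup.map φ (𝓡.ρ g) = P⁻¹ * r g * P)
    {x : CompletedCohomologyHeckeAlgebraGLn 𝒰 →+* PadicAlgCl p} (hx : Continuous x)
    (hass : 𝒰.IsAssociated x r) (t : CompletedCohomologyHeckeAlgebraGLn 𝒰) : x t ∈ φ.range := by
  -- (1) the generators `T_{v,i}`
  have hT : ∀ v ∉ 𝒰.bad, ∀ i, x (𝒰.heckeT v i) ∈ φ.range ∧
      (2 ≤ i → ∃ w : (𝓡.R)ˣ, x (𝒰.heckeT v i) = φ w) := by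
    intro v hv i
    obtain ⟨𝔓, h𝔓⟩ := v.primesAbove_nonempty
    obtain ⟨σ, hσ⟩ := HeightOneSpectrum.exists_isArithFrobAt_of_mem_primesAbove_holds h𝔓
    obtain ⟨htr, hdet⟩ :=
      Summit.Langlands.Langlands.Theorems.EisensteinProModularSeed.Negative.trace_det_frob_of_isAssociated
        hass hv h𝔓 hσ
    -- trace and determinant of `r σ` are `φ` of those of `ρ_𝒟 σ`
    have hconj : (r σ).val = P.val * (Matrix.GeneralLinearGroup.map φ (𝓡.ρ σ)).val * (P⁻¹).val := by
      rw [hreal σ, Units.val_mul, Units.val_mul]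
      rw [← Matrix.mul_assoc, ← Matrix.mul_assoc, ← Units.val_mul, mul_inv_cancel, Units.val_one,
        Matrix.one_mul, Matrix.mul_assoc, ← Units.val_mul, mul_inv_cancel, Units.val_one, Matrix.mul_one]
    have htr' : (r σ).val.trace = φ (𝓡.ρ σ).val.trace := by
      rw [hconj, Matrix.trace_units_conj]
      change ((𝓡.ρ σ).val.map φ).trace = _
      rw [Matrix.trace_fin_two, Matrix.trace_fin_two, Matrix.map_apply, Matrix.map_apply, map_add]
    have hdet' : (r σ).val.det = φ (𝓡.ρ σ).val.det := by
      rw [hconj, Matrix.det_units_conj]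
      change ((𝓡.ρ σ).val.map φ).det = _
      rw [RingHom.map_det, RingHom.mapMatrix_apply]
    obtain ⟨u, hu⟩ := hq v hv
    have hφu : φ u = (Ideal.absNorm v.asIdeal : PadicAlgCl p) := by rw [hu, map_natCast]
    have hq0 : (Ideal.absNorm v.asIdeal : PadicAlgCl p) ≠ 0 := by
      have : Ideal.absNorm v.asIdeal ≠ 0 := by
        rw [Ne, Ideal.absNorm_eq_zero_iff]
        exact v.ne_bot
      exact_mod_cast this
    -- `x(T_{v,2}) = φ(u⁻¹ det)`
    have h2 : x (𝒰.heckeT v 2) = φ (↑u⁻¹ * (𝓡.ρ σ).val.det) := by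
      apply mul_left_cancel₀ hq0
      rw [← hdet, hdet', ← hφu, ← map_mul, ← mul_assoc, Units.mul_inv, one_mul]
    rcases Nat.eq_zero_or_pos i with rfl | hi
    · refine ⟨?_, fun h => absurd h (by decide)⟩
      rw [heckeT_zero 𝒰 hv, map_one]
      exact φ.range.one_mem
    rcases Nat.lt_or_ge i 2 with hi2 | hi2
    · -- `i = 1`: the trace
      obtain rfl : i = 1 := by omega
      refine ⟨?_, fun h => absurd h (by decide)⟩
      rw [← htr, htr']
      exact ⟨_, rfl⟩
    · -- `i ≥ 2`: `T_{v,i} = T_{v,2}`, the twisted determinant (a unit)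
      rw [heckeT_eq_of_le 𝒰 v hi2, h2]
      refine ⟨⟨_, rfl⟩, fun _ => ⟨u⁻¹ * (Matrix.GeneralLinearGroup.det (𝓡.ρ σ)), ?_⟩⟩
      rw [Units.val_mul]
      rfl
  -- (2) the inverse generators
  have hinv : ∀ v (hv : v ∉ 𝒰.bad),
      x ⟨𝒰.heckeOperator (heckeElement 2 F v 2)⁻¹, heckeOperator_inv_mem 𝒰 hv⟩ ∈ φ.range := by
    intro v hv
    obtain ⟨w, hw⟩ := (hT v hv 2).2 le_rfl
    have h1 := congrArg x (heckeOperator_inv_mul_heckeT 𝒰 hv)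
    rw [map_mul, map_one, hw] at h1
    -- `x(S) · φ w = 1`, so `x(S) = φ (w⁻¹)`
    refine ⟨↑w⁻¹, ?_⟩
    calc φ ↑w⁻¹ = x ⟨𝒰.heckeOperator (heckeElement 2 F v 2)⁻¹, heckeOperator_inv_mem 𝒰 hv⟩ *
          φ w * φ ↑w⁻¹ := by rw [h1, one_mul]
      _ = x ⟨𝒰.heckeOperator (heckeElement 2 F v 2)⁻¹, heckeOperator_inv_mem 𝒰 hv⟩ := by
          rw [mul_assoc, ← map_mul, Units.mul_inv, map_one, mul_one]
  -- (3) the generated subring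
  have hgen : ∀ (a : 𝒰.bigEnd) (ha : a ∈ Subring.closure 𝒰.heckeGenerators),
      x ⟨a, (Subring.closure 𝒰.heckeGenerators).le_topologicalClosure ha⟩ ∈ φ.range := by
    intro a ha
    induction ha using Subring.closure_induction with
    | mem a ha =>
      rcases ha with ⟨v, hv, i, rfl⟩ | ⟨v, hv, rfl⟩
      · have e : (⟨𝒰.heckeOperator (heckeElement 2 F v i), (Subring.closure 𝒰.heckeGenerators).le_topologicalClosure
            (Subring.subset_closure (Or.inl ⟨v, hv, i, rfl⟩))⟩ : CompletedCohomologyHeckeAlgebraGLn 𝒰) =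
            𝒰.heckeT v i := Subtype.ext (by rw [𝒰.coe_heckeT hv i])
        rw [e]
        exact (hT v hv i).1
      · exact hinv v hv
    | zero =>
      have e : (⟨(0 : 𝒰.bigEnd), (Subring.closure 𝒰.heckeGenerators).le_topologicalClosure
          (Subring.closure 𝒰.heckeGenerators).zero_mem⟩ : CompletedCohomologyHeckeAlgebraGLn 𝒰) = 0 := rfl
      rw [e, map_zero]; exact φ.range.zero_mem
    | one =>
      have e : (⟨(1 : 𝒰.bigEnd), (Subring.closure 𝒰.heckeGenerators).le_topologicalClosure
          (Subring.closure 𝒰.heckeGenerators).one_mem⟩ : CompletedCohomologyHeckeAlgebraGLn 𝒰) = 1 := rfl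
      rw [e, map_one]; exact φ.range.one_mem
    | add a b ha hb iha ihb =>
      have e : (⟨a + b, (Subring.closure 𝒰.heckeGenerators).le_topologicalClosure
          ((Subring.closure 𝒰.heckeGenerators).add_mem ha hb)⟩ : CompletedCohomologyHeckeAlgebraGLn 𝒰) =
          ⟨a, (Subring.closure 𝒰.heckeGenerators).le_topologicalClosure ha⟩ +
            ⟨b, (Subring.closure 𝒰.heckeGenerators).le_topologicalClosure hb⟩ := rfl
      rw [e, map_add]; exact φ.range.add_mem iha ihb
    | neg a ha iha =>
      have e : (⟨-a, (Subring.closure 𝒰.heckeGenerators).le_topologicalClosure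
          ((Subring.closure 𝒰.heckeGenerators).neg_mem ha)⟩ : CompletedCohomologyHeckeAlgebraGLn 𝒰) =
          -⟨a, (Subring.closure 𝒰.heckeGenerators).le_topologicalClosure ha⟩ := rfl
      rw [e, map_neg]; exact φ.range.neg_mem iha
    | mul a b ha hb iha ihb =>
      have e : (⟨a * b, (Subring.closure 𝒰.heckeGenerators).le_topologicalClosure
          ((Subring.closure 𝒰.heckeGenerators).mul_mem ha hb)⟩ : CompletedCohomologyHeckeAlgebraGLn 𝒰) =
          ⟨a, (Subring.closure 𝒰.heckeGenerators).le_topologicalClosure ha⟩ *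
            ⟨b, (Subring.closure 𝒰.heckeGenerators).le_topologicalClosure hb⟩ := rfl
      rw [e, map_mul]; exact φ.range.mul_mem iha ihb
  -- (4) `φ(R)` is closed (image of a compact), and the generated subring is dense in `𝕋(𝒰)`
  have hclosed : IsClosed (φ.range : Set (PadicAlgCl p)) := by
    letI : TopologicalSpace 𝓡.R := (maximalIdeal 𝓡.R).adicTopology
    haveI := finite_residueField 𝓡
    haveI : CompactSpace 𝓡.R := compactSpace_adic_of_isNoetherianRing 𝓡.R
    rw [RingHom.coe_range]
    exact (isCompact_range hφ).isClosed
  have hdense : Dense {t : CompletedCohomologyHeckeAlgebraGLn 𝒰 |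
      (t : 𝒰.bigEnd) ∈ Subring.closure 𝒰.heckeGenerators} := by
    have : Dense ((Subtype.val : CompletedCohomologyHeckeAlgebraGLn 𝒰 → 𝒰.bigEnd) ⁻¹'
        (Subring.closure 𝒰.heckeGenerators : Set 𝒰.bigEnd)) := by
      rw [Subtype.dense_iff]
      intro s hs
      have hsub : (Subring.closure 𝒰.heckeGenerators : Set 𝒰.bigEnd) ⊆
          (Subtype.val : CompletedCohomologyHeckeAlgebraGLn 𝒰 → 𝒰.bigEnd) ''
            ((Subtype.val : CompletedCohomologyHeckeAlgebraGLn 𝒰 → 𝒰.bigEnd) ⁻¹'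
              (Subring.closure 𝒰.heckeGenerators : Set 𝒰.bigEnd)) := by
        intro a ha
        exact ⟨⟨a, (Subring.closure 𝒰.heckeGenerators).le_topologicalClosure ha⟩, ha, rfl⟩
      exact closure_mono hsub hs
    exact this
  -- closed set `x⁻¹(φ(R))` containing a dense set is everything
  have hall : (x ⁻¹' (φ.range : Set (PadicAlgCl p))) = Set.univ := by
    apply Set.eq_univ_of_univ_subset
    rw [← hdense.closure_eq]
    exact closure_minimal (fun s hs => hgen s.1 hs) (hclosed.preimage hx)
  have := Set.eq_univ_iff_forall.mp hall t
  exact this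

/-- **Entrance of the prime/point dictionary: the prime `ker φ` of a `p`-adically automorphic point
is pro-modular.**  Let `k` be finite, `φ : R_𝒟 → ℚ̄_p` continuous (`𝔪`-adic to `p`-adic) realising the
continuous `r : Γ_F → GL₂(ℚ̄_p)` up to conjugation (`φ ∘ ρ_𝒟 = P⁻¹ r P`), with `q_v ∈ R_𝒟ˣ` for
`v ∉ S`.  If `r` is `p`-adically automorphic of tame level `𝒰`, then `ker φ` is a pro-modular prime of
`R_𝒟` at level `𝒰` (`IsProModularPrimeAt`): this is the ONE pro-modular point that the seed hands to
Skinner–Wiles' steps (I)+(III). [cite: SkinnerWiles1999, §4.1 p. 62; §4.4 proof of Prop. 4.2] -/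
theorem isProModularPrimeAt_ker_of_isPadicallyAutomorphic [Finite k] (𝒰 : TameLevel 2 F p)
    (φ : 𝓡.R →+* PadicAlgCl p)
    (hφ : @Continuous 𝓡.R (PadicAlgCl p) (maximalIdeal 𝓡.R).adicTopology _ φ)
    (hq : ∀ v ∉ 𝒰.bad, IsUnit ((Ideal.absNorm v.asIdeal : ℕ) : 𝓡.R))
    (r : FramedGaloisRep F (PadicAlgCl p) 2) (P : GL (Fin 2) (PadicAlgCl p))
    (hreal : ∀ g, Matrix.GeneralLinearGroup.map φ (𝓡.ρ g) = P⁻¹ * r g * P)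
    (hr : 𝒰.IsPadicallyAutomorphic r) :
    IsProModularPrimeAt 𝓡 𝒰 ⟨RingHom.ker φ, ker_isPrime 𝓡 φ⟩ := by
  obtain ⟨x, hx, hass⟩ := hr
  have hmem : ∀ t, x t ∈ φ.range := apply_mem_range_of_isAssociated 𝓡 𝒰 φ hφ hq r P hreal hx hass
  -- the injection `ι : R/ker φ ↪ ℚ̄_p` and the ring isomorphism `E : R/ker φ ≃ φ(R)`
  set ι : 𝓡.R ⧸ RingHom.ker φ →+* PadicAlgCl p := RingHom.kerLift φ with hι
  have hιmk : ∀ a, ι (Ideal.Quotient.mk (RingHom.ker φ) a) = φ a := fun a => RingHom.kerLift_mk φ a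
  have hιinj : Function.Injective ι := RingHom.kerLift_injective φ
  have hιmem : ∀ y, ι y ∈ φ.range := by
    intro y
    obtain ⟨a, rfl⟩ := Ideal.Quotient.mk_surjective y
    exact ⟨a, (hιmk a).symm⟩
  let E₀ : 𝓡.R ⧸ RingHom.ker φ →+* φ.range := ι.codRestrict φ.range hιmem
  have hE₀ : Function.Bijective E₀ := by
    refine ⟨fun a b h => hιinj (congrArg Subtype.val h : _), fun z => ?_⟩
    obtain ⟨a, ha⟩ := z.2
    exact ⟨Ideal.Quotient.mk _ a, Subtype.ext (by rw [← ha]; exact hιmk a)⟩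
  let E : 𝓡.R ⧸ RingHom.ker φ ≃+* φ.range := RingEquiv.ofBijective E₀ hE₀
  have hEval : ∀ y, ((E y : φ.range) : PadicAlgCl p) = ι y := fun _ => rfl
  -- the factored point
  let x' : CompletedCohomologyHeckeAlgebraGLn 𝒰 →+* 𝓡.R ⧸ RingHom.ker φ :=
    E.symm.toRingHom.comp (x.codRestrict φ.range hmem)
  have hx' : ∀ t, ι (x' t) = x t := by
    intro t
    rw [← hEval]
    change ((E (E.symm ⟨x t, hmem t⟩) : φ.range) : PadicAlgCl p) = x t
    rw [E.apply_symm_apply]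
  -- topology: `R/ker φ` is compact (image of compact `R`), `E` is a continuous bijection onto a
  -- Hausdorff space, hence a homeomorphism, so `x' = E⁻¹ ∘ x` is continuous
  let tQ : TopologicalSpace (𝓡.R ⧸ RingHom.ker φ) :=
    ((maximalIdeal 𝓡.R).map (Ideal.Quotient.mk (RingHom.ker φ))).adicTopology
  have hcontι : @Continuous _ _ tQ _ ι := continuous_kerLift_adic (maximalIdeal 𝓡.R) φ hφ
  have hcontmk : @Continuous _ _ (maximalIdeal 𝓡.R).adicTopology tQ
      (Ideal.Quotient.mk (RingHom.ker φ)) := by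
    letI : WithIdeal 𝓡.R := ⟨maximalIdeal 𝓡.R⟩
    letI : WithIdeal (𝓡.R ⧸ RingHom.ker φ) := ⟨(maximalIdeal 𝓡.R).map (Ideal.Quotient.mk (RingHom.ker φ))⟩
    exact (WithIdeal.uniformContinuous_of_map_le (f := Ideal.Quotient.mk (RingHom.ker φ)) le_rfl).continuous
  have hcompQ : @CompactSpace (𝓡.R ⧸ RingHom.ker φ) tQ := by
    letI : TopologicalSpace 𝓡.R := (maximalIdeal 𝓡.R).adicTopology
    haveI := finite_residueField 𝓡
    haveI : CompactSpace 𝓡.R := compactSpace_adic_of_isNoetherianRing 𝓡.R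
    letI : TopologicalSpace (𝓡.R ⧸ RingHom.ker φ) := tQ
    refine ⟨?_⟩
    rw [← Set.image_univ_of_surjective Ideal.Quotient.mk_surjective]
    exact isCompact_univ.image hcontmk
  have hcontx' : @Continuous _ _ _ tQ x' := by
    letI : TopologicalSpace (𝓡.R ⧸ RingHom.ker φ) := tQ
    haveI : CompactSpace (𝓡.R ⧸ RingHom.ker φ) := hcompQ
    have hE : Continuous E.toEquiv := by
      change Continuous E₀
      exact hcontι.subtype_mk _
    have hsymm : Continuous E.toEquiv.symm := hE.continuous_symm_of_equiv_compact_to_t2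
    change Continuous (fun t => E.symm (x.codRestrict φ.range hmem t))
    exact hsymm.comp (hx.subtype_mk _)
  -- the association data descend along the injection `ι`
  refine ⟨x', hcontx', fun v hv => ?_⟩
  obtain ⟨hunr, hchar⟩ := hass v hv
  have hmod : ∀ g, Matrix.GeneralLinearGroup.map ι (𝓡.modPrime ⟨RingHom.ker φ, ker_isPrime 𝓡 φ⟩ g) =
      P⁻¹ * r g * P := fun g => by
    have hιmk' : ι.comp (Ideal.Quotient.mk (RingHom.ker φ)) = φ := RingHom.ext hιmk
    change Matrix.GeneralLinearGroup.map ι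
      (Matrix.GeneralLinearGroup.map (Ideal.Quotient.mk (RingHom.ker φ)) (𝓡.ρ g)) = _
    rw [← Matrix.GeneralLinearGroup.map_comp_apply, ← Matrix.GeneralLinearGroup.map_comp, hιmk', hreal]
  refine ⟨fun 𝔓 h𝔓 σ hσ => ?_, fun 𝔓 h𝔓 σ hσ => ?_⟩
  · -- unramified: `ι (ρ_𝒟 σ mod ker φ) = P⁻¹ r σ P = 1` and `ι` is injective
    apply Literature.NumberTheory.GaloisRepresentations.Deformation.generalLinearGroup_map_injective ι hιinj
    rw [hmod σ, hunr 𝔓 h𝔓 σ hσ, map_one]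
    group
  · -- characteristic polynomial: compare after `Polynomial.map ι` (injective)
    apply Polynomial.map_injective ι hιinj
    rw [← Matrix.charpoly_map, heckeFrobPoly_map]
    have hmat : ((𝓡.modPrime ⟨RingHom.ker φ, ker_isPrime 𝓡 φ⟩ σ).val).map ι = (P⁻¹ * r σ * P).val := by
      rw [← hmod σ]; rfl
    rw [hmat, Units.val_mul, Units.val_mul, Matrix.coe_units_inv, Matrix.charpoly_units_conj']
    have e : (fun i => ι (x' (𝒰.heckeT v i))) = fun i => x (𝒰.heckeT v i) := funext fun i => hx' _
    rw [e]
    exact hchar 𝔓 h𝔓 σ hσ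

end

end Summit.Langlands.Langlands.Cruxes.ReducibleOrdinaryProModular.SteinbergHyperplane
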